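import Mathlib.Combinatorics.SetFamily.FourFunctions
import Summits.CriticalPhenomena.PercolationContinuityZ3.Theorems.PercNearOneGluingAdditiveGluingAvoidanceCovBernsteinTools
import HarnessLib

/-!
# Bernstein positivity of avoidance covariances (the two-slot symmetrised inequality "(SYM2)")

Support lemma for the crux `AdditiveGluing` (stmt-CriticalPhenomena-4576), line `tieline`,
kernel `stub_k0CovTransferQ_c9`.  Expanding the killed ("ghost-avoiding") cluster laws of the
kernel's L-face master inequality over the ghost's kill pattern turns it into positivity
statements for *symmetrised multi-slot avoidance forms* in plain Bernoulli percolation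
(memo `EXCHCERT-g5.md` §7–§8 on the item).  This file proves the two-slot member of that family,
a strengthening of van den Berg–Häggström–Kahn 2006, Thm. 1.3:

for bond percolation `μ = prodBernoulli w` on a finite graph, a vertex `v`, two events `𝒰, 𝒪`
increasing in the open edge cluster `C_v`, and disjoint vertex sets `Z, A` not containing `v`,
writing `R_X = {v ↮ X}`,

`0 ≤ ∑_{S ⊆ A} [ μ(𝒰 ∩ 𝒪 ∩ R_{Z ∪ S}) μ(R_{Z ∪ (A∖S)}) − μ(𝒰 ∩ R_{Z ∪ S}) μ(𝒪 ∩ R_{Z ∪ (A∖S)}) ]`.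

For `A = ∅` this is BHK Thm. 1.3 (positive association of `C_v` given `{v ↮ Z}`); for general `A`
it says that the un-normalised covariance of `𝒰, 𝒪` under the law of `C_v` killed independently at
the vertices of `A` has non-negative multivariate Bernstein coefficients in the kill probabilities.

Proof (paper proof in the memo, §8.1): pair `S` with `A ∖ S`; the pair sum equals
`w(S)·[Cov(𝒰,𝒪 | R_a) + Cov(𝒰,𝒪 | R_b) + (f a − f b)(g a − g b)]` with `a = Z ∪ S`,
`b = Z ∪ (A∖S)`, `w(S) = μ(R_a)μ(R_b)`, `f X = μ(𝒰 | R_X)`, `g X = μ(𝒪 | R_X)`; the conditional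
covariances are `≥ 0` by BHK Thm. 1.3, `f, g` are antitone in the avoidance set (BHK Thm. 1.3,
increasing × decreasing case), `w` is log-supermodular on the Boolean lattice `2^A` (BHK Thm. 1.3,
decreasing × decreasing case), and the odd parts `S ↦ f a − f b`, `S ↦ g a − g b` have `w`-mean
zero, so the Fortuin–Kasteleyn–Ginibre inequality on `(2^A, w)` (Mathlib `fkg`) gives
`∑ w (f a − f b)(g a − g b) ≥ 0`.

References: J. van den Berg, O. Häggström, J. Kahn, *Some conditional correlation inequalities for
percolation and related processes*, Random Struct. Alg. 29 (2006), Thm. 1.1 (p. 3), Thm. 1.3 (p. 6)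
[VandenbergHaggstromKahn2005]; C. Fortuin, P. Kasteleyn, J. Ginibre (1971) / R. Ahlswede,
D. Daykin (1978), four functions theorem (Mathlib `four_functions_theorem`, `fkg`).
-/

namespace Summit.CriticalPhenomena.PercolationContinuityZ3.Theorems

open MeasureTheory Set
open Literature.Probability.LatticeModels (prodBernoulli)
open Literature.Probability.Percolation Literature.Probability.Percolation.KNPreFKG

open AvoidanceCovBernstein Finset in
/-- **Bernstein positivity of avoidance covariances ("(SYM2)").**  For bond percolation
`μ = prodBernoulli w` on a finite graph, a vertex `v`, upper families `𝒜, ℬ` of edge sets (read on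
the open edge cluster `C_v`, giving the increasing events `𝒰 = {C_v ∈ 𝒜}`, `𝒪 = {C_v ∈ ℬ}`), and
vertex sets `Z, A` with `v ∉ Z`, `v ∉ A`: with `R_X = {v ↮ X}`,
`0 ≤ ∑_{S ⊆ A} [ μ(𝒰 ∩ 𝒪 ∩ R_{Z∪S}) μ(R_{Z∪(A∖S)}) − μ(𝒰 ∩ R_{Z∪S}) μ(𝒪 ∩ R_{Z∪(A∖S)}) ]`.
`A = ∅` is BHK 2006 Thm. 1.3; in general these are the multivariate Bernstein coefficients (in the
kill probabilities) of the un-normalised covariance of `𝒰, 𝒪` under the law of `C_v` killed at `A`.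
Proof: pairing `S ↔ A ∖ S`, BHK Thm. 1.3 in its three event forms (`pa`, `mono`, `logsuper`) and the
FKG inequality on the Boolean lattice `(Finset V, w)` (Mathlib `fkg`).
[cite: VandenbergHaggstromKahn2005, Thm. 1.3 (p. 6), Thm. 1.1 (p. 3)] -/
theorem avoidanceCov_bernstein {V : Type*} [Fintype V] [DecidableEq V]
    (w : Sym2 V → unitInterval) (v : V) {𝒜 ℬ : Set (Set (Sym2 V))}
    (h𝒜 : IsUpperSet 𝒜) (hℬ : IsUpperSet ℬ) (Z A : Finset V) (hvZ : v ∉ Z) (hvA : v ∉ A) :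
    0 ≤ ∑ S ∈ A.powerset,
      ((prodBernoulli w).real ({ω : BondConfig V | openEdgeCluster ω v ∈ 𝒜} ∩
          {ω : BondConfig V | openEdgeCluster ω v ∈ ℬ} ∩
          {ω | ∀ x ∈ Z ∪ S, ¬ (openGraph ω).Reachable v x}) *
        (prodBernoulli w).real {ω : BondConfig V | ∀ x ∈ Z ∪ (A \ S), ¬ (openGraph ω).Reachable v x} -
      (prodBernoulli w).real ({ω : BondConfig V | openEdgeCluster ω v ∈ 𝒜} ∩
          {ω | ∀ x ∈ Z ∪ S, ¬ (openGraph ω).Reachable v x}) *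
        (prodBernoulli w).real ({ω : BondConfig V | openEdgeCluster ω v ∈ ℬ} ∩
          {ω | ∀ x ∈ Z ∪ (A \ S), ¬ (openGraph ω).Reachable v x})) := by
  classical
  set μ := prodBernoulli w with hμ
  -- the four set functions of the avoidance set
  set Zf : Finset V → ℝ := fun X => μ.real {ω : BondConfig V | ∀ x ∈ X, ¬ (openGraph ω).Reachable v x}
    with hZf
  set uf : Finset V → ℝ := fun X => μ.real ({ω : BondConfig V | openEdgeCluster ω v ∈ 𝒜} ∩
    {ω | ∀ x ∈ X, ¬ (openGraph ω).Reachable v x}) with huf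
  set of' : Finset V → ℝ := fun X => μ.real ({ω : BondConfig V | openEdgeCluster ω v ∈ ℬ} ∩
    {ω | ∀ x ∈ X, ¬ (openGraph ω).Reachable v x}) with hof
  set uof : Finset V → ℝ := fun X => μ.real ({ω : BondConfig V | openEdgeCluster ω v ∈ 𝒜} ∩
    {ω : BondConfig V | openEdgeCluster ω v ∈ ℬ} ∩
    {ω | ∀ x ∈ X, ¬ (openGraph ω).Reachable v x}) with huof
  -- the summand
  set term : Finset V → ℝ := fun S => uof (Z ∪ S) * Zf (Z ∪ (A \ S)) - uf (Z ∪ S) * of' (Z ∪ (A \ S))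
    with hterm
  show 0 ≤ ∑ S ∈ A.powerset, term S
  -- basic bounds
  have hZf0 : ∀ X, 0 ≤ Zf X := fun X => measureReal_nonneg
  have huf0 : ∀ X, 0 ≤ uf X := fun X => measureReal_nonneg
  have hof0 : ∀ X, 0 ≤ of' X := fun X => measureReal_nonneg
  have huof0 : ∀ X, 0 ≤ uof X := fun X => measureReal_nonneg
  have huf_le : ∀ X, uf X ≤ Zf X := fun X => measureReal_mono inter_subset_right
  have hof_le : ∀ X, of' X ≤ Zf X := fun X => measureReal_mono inter_subset_right
  have huof_le : ∀ X, uof X ≤ uf X := fun X =>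
    measureReal_mono (inter_subset_inter_left _ inter_subset_left)
  have hv_of : ∀ {X : Finset V}, X ⊆ Z ∪ A → v ∉ X := fun hX h =>
    (Finset.mem_union.1 (hX h)).elim hvZ hvA
  -- (a1) positive association, (a2) monotonicity, (a3) log-supermodularity
  have hPA : ∀ X, X ⊆ Z ∪ A → uf X * of' X ≤ Zf X * uof X := fun X hX => pa w v 𝒜 ℬ h𝒜 hℬ X (hv_of hX)
  have hmono_u : ∀ X X', X ⊆ X' → X' ⊆ Z ∪ A → Zf X * uf X' ≤ uf X * Zf X' :=
    fun X X' h h' => mono w v 𝒜 h𝒜 h (hv_of h')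
  have hmono_o : ∀ X X', X ⊆ X' → X' ⊆ Z ∪ A → Zf X * of' X' ≤ of' X * Zf X' :=
    fun X X' h h' => mono w v ℬ hℬ h (hv_of h')
  have hlog : ∀ X Y, X ⊆ Z ∪ A → Y ⊆ Z ∪ A → Zf X * Zf Y ≤ Zf (X ∩ Y) * Zf (X ∪ Y) :=
    fun X Y hX hY => logsuper w v (hv_of hX) (hv_of hY)
  -- conditional probabilities (with the convention x / 0 = 0)
  set f : Finset V → ℝ := fun X => uf X / Zf X with hf
  set g : Finset V → ℝ := fun X => of' X / Zf X with hg
  set h : Finset V → ℝ := fun X => uof X / Zf X with hh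
  have hf_mul : ∀ X, f X * Zf X = uf X := by
    intro X; by_cases hz : Zf X = 0
    · have : uf X = 0 := le_antisymm (hz ▸ huf_le X) (huf0 X)
      simp [hf, hz, this]
    · exact div_mul_cancel₀ _ hz
  have hg_mul : ∀ X, g X * Zf X = of' X := by
    intro X; by_cases hz : Zf X = 0
    · have : of' X = 0 := le_antisymm (hz ▸ hof_le X) (hof0 X)
      simp [hg, hz, this]
    · exact div_mul_cancel₀ _ hz
  have hh_mul : ∀ X, h X * Zf X = uof X := by
    intro X; by_cases hz : Zf X = 0
    · have : uof X = 0 := le_antisymm (hz ▸ (huof_le X).trans (huf_le X)) (huof0 X)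
      simp [hh, hz, this]
    · exact div_mul_cancel₀ _ hz
  have hf0 : ∀ X, 0 ≤ f X := fun X => div_nonneg (huf0 X) (hZf0 X)
  have hg0 : ∀ X, 0 ≤ g X := fun X => div_nonneg (hof0 X) (hZf0 X)
  have hf1 : ∀ X, f X ≤ 1 := fun X => div_le_one_of_le₀ (huf_le X) (hZf0 X)
  have hg1 : ∀ X, g X ≤ 1 := fun X => div_le_one_of_le₀ (hof_le X) (hZf0 X)
  -- (a1) in ratio form: `f g ≤ h` (times `Zf`)
  have hPA' : ∀ X, X ⊆ Z ∪ A → Zf X * (f X * g X) ≤ Zf X * h X := by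
    intro X hX
    by_cases hz : Zf X = 0
    · simp [hz]
    · have hzpos : 0 < Zf X := lt_of_le_of_ne (hZf0 X) (Ne.symm hz)
      have := hPA X hX
      rw [← hf_mul, ← hg_mul, ← hh_mul] at this
      -- f Z * (g Z) ≤ Z * (h Z)  after cancelling one `Zf X > 0`
      have : (f X * g X) * (Zf X * Zf X) ≤ h X * (Zf X * Zf X) := by nlinarith
      nlinarith
  -- (a2) in ratio form: `f` (and `g`) antitone in the avoidance set inside `Z ∪ A`
  have hf_anti : ∀ X X', X ⊆ X' → X' ⊆ Z ∪ A → f X' ≤ f X := by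
    intro X X' hXX' hX'
    by_cases hz' : Zf X' = 0
    · simp only [hf, hz', div_zero]; exact hf0 X
    · have hz'pos : 0 < Zf X' := lt_of_le_of_ne (hZf0 X') (Ne.symm hz')
      have hzpos : 0 < Zf X := lt_of_lt_of_le hz'pos (measureReal_mono (R_anti v hXX'))
      have key := hmono_u X X' hXX' hX'
      rw [← hf_mul X, ← hf_mul X'] at key
      -- Zf X * (f X' * Zf X') ≤ f X * Zf X * Zf X'
      have : f X' * (Zf X * Zf X') ≤ f X * (Zf X * Zf X') := by nlinarith
      exact le_of_mul_le_mul_right this (mul_pos hzpos hz'pos)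
  have hg_anti : ∀ X X', X ⊆ X' → X' ⊆ Z ∪ A → g X' ≤ g X := by
    intro X X' hXX' hX'
    by_cases hz' : Zf X' = 0
    · simp only [hg, hz', div_zero]; exact hg0 X
    · have hz'pos : 0 < Zf X' := lt_of_le_of_ne (hZf0 X') (Ne.symm hz')
      have hzpos : 0 < Zf X := lt_of_lt_of_le hz'pos (measureReal_mono (R_anti v hXX'))
      have key := hmono_o X X' hXX' hX'
      rw [← hg_mul X, ← hg_mul X'] at key
      have : g X' * (Zf X * Zf X') ≤ g X * (Zf X * Zf X') := by nlinarith
      exact le_of_mul_le_mul_right this (mul_pos hzpos hz'pos)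
  -- the weight on the Boolean lattice `Finset V` (zero off `A.powerset`) and the odd functions
  set wt : Finset V → ℝ := fun S => if S ⊆ A then Zf (Z ∪ S) * Zf (Z ∪ (A \ S)) else 0 with hwt
  set F : Finset V → ℝ := fun S => f (Z ∪ (A \ S)) - f (Z ∪ (S ∩ A)) with hF
  set G : Finset V → ℝ := fun S => g (Z ∪ (A \ S)) - g (Z ∪ (S ∩ A)) with hG
  have hsubZA : ∀ S : Finset V, Z ∪ (A \ S) ⊆ Z ∪ A := fun S =>
    Finset.union_subset_union (subset_refl _) Finset.sdiff_subset
  have hsubZA' : ∀ S : Finset V, Z ∪ (S ∩ A) ⊆ Z ∪ A := fun S =>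
    Finset.union_subset_union (subset_refl _) Finset.inter_subset_right
  have hwt0 : 0 ≤ wt := fun S => by
    simp only [hwt]; split_ifs
    · exact mul_nonneg (hZf0 _) (hZf0 _)
    · exact le_rfl
  have hFmono : Monotone F := by
    intro S T hST
    simp only [hF]
    have h1 : f (Z ∪ (A \ S)) ≤ f (Z ∪ (A \ T)) :=
      hf_anti _ _ (Finset.union_subset_union (subset_refl _) (Finset.sdiff_subset_sdiff
        (subset_refl _) hST)) (hsubZA S)
    have h2 : f (Z ∪ (T ∩ A)) ≤ f (Z ∪ (S ∩ A)) :=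
      hf_anti _ _ (Finset.union_subset_union (subset_refl _)
        (Finset.inter_subset_inter hST (subset_refl _))) (hsubZA' T)
    linarith
  have hGmono : Monotone G := by
    intro S T hST
    simp only [hG]
    have h1 : g (Z ∪ (A \ S)) ≤ g (Z ∪ (A \ T)) :=
      hg_anti _ _ (Finset.union_subset_union (subset_refl _) (Finset.sdiff_subset_sdiff
        (subset_refl _) hST)) (hsubZA S)
    have h2 : g (Z ∪ (T ∩ A)) ≤ g (Z ∪ (S ∩ A)) :=
      hg_anti _ _ (Finset.union_subset_union (subset_refl _)
        (Finset.inter_subset_inter hST (subset_refl _))) (hsubZA' T)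
    linarith
  -- log-supermodularity of the weight on the Boolean lattice `Finset V`
  have hwt_sub : ∀ S, S ⊆ A → wt S = Zf (Z ∪ S) * Zf (Z ∪ (A \ S)) := fun S hS => by
    simp only [hwt, if_pos hS]
  have hwt_not : ∀ S, ¬ S ⊆ A → wt S = 0 := fun S hS => by simp only [hwt, if_neg hS]
  have hwt_log : ∀ S T, wt S * wt T ≤ wt (S ⊓ T) * wt (S ⊔ T) := by
    intro S T
    show wt S * wt T ≤ wt (S ∩ T) * wt (S ∪ T)
    by_cases hS : S ⊆ A
    · by_cases hT : T ⊆ A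
      · have hST1 : S ∩ T ⊆ A := Finset.inter_subset_left.trans hS
        have hST2 : S ∪ T ⊆ A := Finset.union_subset hS hT
        rw [hwt_sub S hS, hwt_sub T hT, hwt_sub _ hST1, hwt_sub _ hST2]
        have h1 := hlog (Z ∪ S) (Z ∪ T) (Finset.union_subset_union (subset_refl _) hS)
          (Finset.union_subset_union (subset_refl _) hT)
        have h2 := hlog (Z ∪ (A \ S)) (Z ∪ (A \ T)) (hsubZA S) (hsubZA T)
        have e1 : (Z ∪ S) ∩ (Z ∪ T) = Z ∪ (S ∩ T) := by
          ext x; simp only [Finset.mem_inter, Finset.mem_union]; tauto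
        have e2 : (Z ∪ S) ∪ (Z ∪ T) = Z ∪ (S ∪ T) := by
          ext x; simp only [Finset.mem_union]; tauto
        have e3 : (Z ∪ (A \ S)) ∩ (Z ∪ (A \ T)) = Z ∪ (A \ (S ∪ T)) := by
          ext x; simp only [Finset.mem_inter, Finset.mem_union, Finset.mem_sdiff]; tauto
        have e4 : (Z ∪ (A \ S)) ∪ (Z ∪ (A \ T)) = Z ∪ (A \ (S ∩ T)) := by
          ext x; simp only [Finset.mem_inter, Finset.mem_union, Finset.mem_sdiff]; tauto
        rw [e1, e2] at h1
        rw [e3, e4] at h2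
        have := mul_le_mul h1 h2 (mul_nonneg (hZf0 _) (hZf0 _)) (mul_nonneg (hZf0 _) (hZf0 _))
        nlinarith [this]
      · rw [hwt_not T hT, mul_zero]; exact mul_nonneg (hwt0 _) (hwt0 _)
    · rw [hwt_not S hS, zero_mul]; exact mul_nonneg (hwt0 _) (hwt0 _)
  -- FKG on `(Finset V, wt)` for the monotone non-negative functions `F + 1`, `G + 1`
  have hF1 : 0 ≤ fun S => F S + 1 := fun S => by
    have h1 := hf0 (Z ∪ (A \ S)); have h2 := hf1 (Z ∪ (S ∩ A))
    show (0 : ℝ) ≤ (f (Z ∪ (A \ S)) - f (Z ∪ (S ∩ A))) + 1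
    linarith
  have hG1 : 0 ≤ fun S => G S + 1 := fun S => by
    have h1 := hg0 (Z ∪ (A \ S)); have h2 := hg1 (Z ∪ (S ∩ A))
    show (0 : ℝ) ≤ (g (Z ∪ (A \ S)) - g (Z ∪ (S ∩ A))) + 1
    linarith
  have hfkg := fkg (f := fun S => F S + 1) (g := fun S => G S + 1) (μ := wt) hwt0 hF1 hG1
    (hFmono.add_const 1) (hGmono.add_const 1) hwt_log
  -- sums over `univ` are sums over `A.powerset`
  have hsum : ∀ φ : Finset V → ℝ, ∑ S, wt S * φ S = ∑ S ∈ A.powerset, wt S * φ S := by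
    intro φ
    symm
    apply Finset.sum_subset (Finset.subset_univ _)
    intro S _ hS
    have hS' : ¬ S ⊆ A := by simpa only [Finset.mem_powerset] using hS
    rw [hwt_not S hS', zero_mul]
  have hsum1 : ∑ S, wt S = ∑ S ∈ A.powerset, wt S := by
    have := hsum (fun _ => 1); simpa only [mul_one] using this
  -- the involution `S ↦ A \ S` of `A.powerset`
  have hinv : ∀ ψ : Finset V → ℝ, ∑ S ∈ A.powerset, ψ (A \ S) = ∑ S ∈ A.powerset, ψ S := by
    intro ψ
    apply Finset.sum_nbij' (fun S => A \ S) (fun S => A \ S)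
    · intro S _; exact Finset.mem_powerset.2 Finset.sdiff_subset
    · intro S _; exact Finset.mem_powerset.2 Finset.sdiff_subset
    · intro S hS; exact Finset.sdiff_sdiff_eq_self (Finset.mem_powerset.1 hS)
    · intro S hS; exact Finset.sdiff_sdiff_eq_self (Finset.mem_powerset.1 hS)
    · intro S _; rfl
  have hwt_symm : ∀ S, S ⊆ A → wt (A \ S) = wt S := by
    intro S hS
    rw [hwt_sub S hS, hwt_sub _ Finset.sdiff_subset, Finset.sdiff_sdiff_eq_self hS, mul_comm]
  have hF_sub : ∀ S, S ⊆ A → F S = f (Z ∪ (A \ S)) - f (Z ∪ S) := by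
    intro S hS; simp only [hF, Finset.inter_eq_left.2 hS]
  have hG_sub : ∀ S, S ⊆ A → G S = g (Z ∪ (A \ S)) - g (Z ∪ S) := by
    intro S hS; simp only [hG, Finset.inter_eq_left.2 hS]
  -- oddness: `∑ wt F = 0`, `∑ wt G = 0`
  have hoddF : ∑ S, wt S * F S = 0 := by
    rw [hsum]
    have e : ∀ S ∈ A.powerset, wt S * F S = wt S * f (Z ∪ (A \ S)) - wt S * f (Z ∪ S) := by
      intro S hS; rw [hF_sub S (Finset.mem_powerset.1 hS)]; ring
    rw [Finset.sum_congr rfl e, Finset.sum_sub_distrib]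
    have h1 := hinv (fun S => wt (A \ S) * f (Z ∪ S))
    have e' : ∀ S ∈ A.powerset, (fun S => wt (A \ S) * f (Z ∪ S)) (A \ S) =
        wt S * f (Z ∪ (A \ S)) := by
      intro S hS
      show wt (A \ (A \ S)) * f (Z ∪ (A \ S)) = wt S * f (Z ∪ (A \ S))
      rw [Finset.sdiff_sdiff_eq_self (Finset.mem_powerset.1 hS)]
    rw [Finset.sum_congr rfl e'] at h1
    have e'' : ∀ S ∈ A.powerset, (fun S => wt (A \ S) * f (Z ∪ S)) S = wt S * f (Z ∪ S) := by
      intro S hS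
      show wt (A \ S) * f (Z ∪ S) = wt S * f (Z ∪ S)
      rw [hwt_symm S (Finset.mem_powerset.1 hS)]
    rw [Finset.sum_congr rfl e''] at h1
    linarith
  have hoddG : ∑ S, wt S * G S = 0 := by
    rw [hsum]
    have e : ∀ S ∈ A.powerset, wt S * G S = wt S * g (Z ∪ (A \ S)) - wt S * g (Z ∪ S) := by
      intro S hS; rw [hG_sub S (Finset.mem_powerset.1 hS)]; ring
    rw [Finset.sum_congr rfl e, Finset.sum_sub_distrib]
    have h1 := hinv (fun S => wt (A \ S) * g (Z ∪ S))
    have e' : ∀ S ∈ A.powerset, (fun S => wt (A \ S) * g (Z ∪ S)) (A \ S) =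
        wt S * g (Z ∪ (A \ S)) := by
      intro S hS
      show wt (A \ (A \ S)) * g (Z ∪ (A \ S)) = wt S * g (Z ∪ (A \ S))
      rw [Finset.sdiff_sdiff_eq_self (Finset.mem_powerset.1 hS)]
    rw [Finset.sum_congr rfl e'] at h1
    have e'' : ∀ S ∈ A.powerset, (fun S => wt (A \ S) * g (Z ∪ S)) S = wt S * g (Z ∪ S) := by
      intro S hS
      show wt (A \ S) * g (Z ∪ S) = wt S * g (Z ∪ S)
      rw [hwt_symm S (Finset.mem_powerset.1 hS)]
    rw [Finset.sum_congr rfl e''] at h1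
    linarith
  -- extract `∑ wt F G ≥ 0` from FKG
  have hP : 0 ≤ ∑ S, wt S * (F S * G S) := by
    have eL1 : ∑ S, wt S * (F S + 1) = ∑ S, wt S := by
      simp only [mul_add, mul_one, Finset.sum_add_distrib, hoddF, zero_add]
    have eL2 : ∑ S, wt S * (G S + 1) = ∑ S, wt S := by
      simp only [mul_add, mul_one, Finset.sum_add_distrib, hoddG, zero_add]
    have eR : ∑ S, wt S * ((F S + 1) * (G S + 1)) = ∑ S, wt S * (F S * G S) + ∑ S, wt S := by
      have : ∀ S, wt S * ((F S + 1) * (G S + 1)) =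
          wt S * (F S * G S) + wt S * F S + wt S * G S + wt S := fun S => by ring
      simp only [this, Finset.sum_add_distrib, hoddF, hoddG, add_zero]
    have key : (∑ S, wt S * (F S + 1)) * ∑ S, wt S * (G S + 1) ≤
        (∑ S, wt S) * ∑ S, wt S * ((F S + 1) * (G S + 1)) := hfkg
    rw [eL1, eL2, eR] at key
    have hW0 : 0 ≤ ∑ S, wt S := Finset.sum_nonneg fun S _ => hwt0 S
    rcases hW0.eq_or_lt with hW | hW
    · -- total weight zero: every weight vanishes
      have hall : ∀ S, wt S = 0 := fun S =>
        (Finset.sum_eq_zero_iff_of_nonneg fun S _ => hwt0 S).1 hW.symm S (Finset.mem_univ S)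
      simp only [hall, zero_mul, Finset.sum_const_zero, le_refl]
    · nlinarith
  -- pairing: `2 ∑ term = ∑ (term S + term (A \ S))`
  have hpair : 2 * ∑ S ∈ A.powerset, term S = ∑ S ∈ A.powerset, (term S + term (A \ S)) := by
    rw [Finset.sum_add_distrib, hinv term]; ring
  -- the pair identity and its sign
  have hpair_ge : ∀ S ∈ A.powerset, wt S * (F S * G S) ≤ term S + term (A \ S) := by
    intro S hS
    have hSA : S ⊆ A := Finset.mem_powerset.1 hS
    have hsd : A \ (A \ S) = S := Finset.sdiff_sdiff_eq_self hSA
    -- abbreviations `a = Z ∪ S`, `b = Z ∪ (A \ S)`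
    have ha : Z ∪ S ⊆ Z ∪ A := Finset.union_subset_union (subset_refl _) hSA
    have hb : Z ∪ (A \ S) ⊆ Z ∪ A := hsubZA S
    have eterm : term S + term (A \ S) =
        uof (Z ∪ S) * Zf (Z ∪ (A \ S)) - uf (Z ∪ S) * of' (Z ∪ (A \ S)) +
        (uof (Z ∪ (A \ S)) * Zf (Z ∪ S) - uf (Z ∪ (A \ S)) * of' (Z ∪ S)) := by
      simp only [hterm, hsd]
    rw [eterm, hwt_sub S hSA, hF_sub S hSA, hG_sub S hSA, ← hh_mul (Z ∪ S), ← hh_mul (Z ∪ (A \ S)),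
      ← hf_mul (Z ∪ S), ← hf_mul (Z ∪ (A \ S)), ← hg_mul (Z ∪ S), ← hg_mul (Z ∪ (A \ S))]
    have p1 := hPA' (Z ∪ S) ha
    have p2 := hPA' (Z ∪ (A \ S)) hb
    have z1 := hZf0 (Z ∪ S)
    have z2 := hZf0 (Z ∪ (A \ S))
    nlinarith [mul_le_mul_of_nonneg_left p1 z2, mul_le_mul_of_nonneg_left p2 z1]
  have hfin : ∑ S, wt S * (F S * G S) ≤ 2 * ∑ S ∈ A.powerset, term S := by
    rw [hsum, hpair]
    exact Finset.sum_le_sum hpair_ge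
  linarith

end Summit.CriticalPhenomena.PercolationContinuityZ3.Theorems
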